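import Literature.NumberTheory.QuadraticFields.BinaryQuadraticFormsClassNumber
import HarnessLib

/-!
# Class numbers of imaginary quadratic discriminants on the bed's `L2` champion lists, part (a): `D = −403, −907, −30067, −34483, −85507, −90787, −111763`

Topic `NumberTheory/QuadraticFields`, namespace `Literature.NumberTheory.QuadraticFields.Quadratic`; pure VALUES file (theorems only):
the form class number `BinQF.classNumber D = h(D)` of `BinaryQuadraticFormsClassNumber.lean` (the number of reduced primitive positive
definite forms of discriminant `D`, Cox Thm. 2.13, computable) evaluated by `decide +kernel` at NEGATIVE fundamental discriminants of the
landau-siegel rescue bed's rule-`L2` champion tables (the 15 least `L(1, χ_D)` and the 15 least `L(1, χ_D)·log log |D|` over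
`200 < |D| ≤ 3·10⁵`, bed-1 spec `bed1-KG1-v0.1`, engines A ≡ B; the heads `−427`, `−222643` are in
`Zhang2022/RepairBedClassNumberFormula.lean`). The files are split (a)–(e) only to bound each file's kernel time (≈ 40 s per 10⁵ of |D|).

| `D` | factorisation | `h(D)` | bed list |
|---|---|---|---|
| `−403` | `13·31` | `2` | loglog #5 |
| `−907` | `907` | `3` | loglog #14 |
| `−30067` | `107·281` | `14` | loglog #10 |
| `−34483` | `34483` | `15` | loglog #11 |
| `−85507` | `37·2311` | `22` | by L(1) #5, loglog #7 |
| `−90787` | `90787` | `23` | by L(1) #9, loglog #8 |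
| `−111763` | `73·1531` | `24` | by L(1) #4, loglog #3 |

First consumer: `Zhang2022/RepairBedClassNumberFormulaNegL2.lean` (`L(1, χ_D) = πh/√|D|`).

## References

* [Cox2013] D. A. Cox, *Primes of the form x² + ny²*, 2nd ed. (2013), §2.A Thm. 2.8, Thm. 2.13 and (2.14).
* [Shanks1973LittlewoodBounds] D. Shanks, Proc. Sympos. Pure Math. 24 (1973) 267–283, §1 (tables of extreme `L(1, χ_d)`).
-/

namespace Literature.NumberTheory.QuadraticFields.Quadratic

/-- **`h(−403) = 2`** (`−403` = −13·31; bed list loglog #5; kernel count of the reduced forms). [cite: Cox2013, Thm. 2.13] -/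
theorem binQFClassNumber_neg403 : BinQF.classNumber (-403) = 2 := by
  decide +kernel

/-- **`h(−907) = 3`** (`−907` prime; bed list loglog #14; kernel count of the reduced forms). [cite: Cox2013, Thm. 2.13] -/
theorem binQFClassNumber_neg907 : BinQF.classNumber (-907) = 3 := by
  decide +kernel

/-- **`h(−30067) = 14`** (`−30067` = −107·281; bed list loglog #10; kernel count of the reduced forms). [cite: Cox2013, Thm. 2.13] -/
theorem binQFClassNumber_neg30067 : BinQF.classNumber (-30067) = 14 := by
  decide +kernel

/-- **`h(−34483) = 15`** (`−34483` prime; bed list loglog #11; kernel count of the reduced forms). [cite: Cox2013, Thm. 2.13] -/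
theorem binQFClassNumber_neg34483 : BinQF.classNumber (-34483) = 15 := by
  decide +kernel

/-- **`h(−85507) = 22`** (`−85507` = −37·2311; bed list by L(1) #5, loglog #7; kernel count of the reduced forms). [cite: Cox2013, Thm. 2.13] -/
theorem binQFClassNumber_neg85507 : BinQF.classNumber (-85507) = 22 := by
  decide +kernel

/-- **`h(−90787) = 23`** (`−90787` prime; bed list by L(1) #9, loglog #8; kernel count of the reduced forms). [cite: Cox2013, Thm. 2.13] -/
theorem binQFClassNumber_neg90787 : BinQF.classNumber (-90787) = 23 := by
  decide +kernel

/-- **`h(−111763) = 24`** (`−111763` = −73·1531; bed list by L(1) #4, loglog #3; kernel count of the reduced forms). [cite: Cox2013, Thm. 2.13] -/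
theorem binQFClassNumber_neg111763 : BinQF.classNumber (-111763) = 24 := by
  decide +kernel

end Literature.NumberTheory.QuadraticFields.Quadratic
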